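import Summits.QuantumFields.YangMills.Theorems.BalabanUVNodesN15KingModelSlicesExactMassGrad
import Summits.QuantumFields.YangMills.Theorems.BalabanUVNodesN15KingModelSlicesExact
import Summits.QuantumFields.YangMills.Theorems.BalabanUVNodesN15KingModelFullPropagatorProfile
import Literature.MathematicalPhysics.QuantumFieldTheory.King1986.TorusCongr
import HarnessLib

/-!
# BalabanUVNodes ∕ N15 — THE KING-MODEL RUNG, CURVED EDITION (PART Ρ-a): KING's GENUINE SLICES `G^η_{(j)}`, `1 ≤ j ≤ k − 1`, READ ON ONE CARRIER
# — the level-`k` fine torus `T_η` — with PROPOSITION 3.7's two sup clauses (3.63) in the schema's spelling: `|G_(j)(x, y)| ≤ C·e^{−δ₀|x−y|∕(L^jη)}`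
# and `|L^j·(G_(j)(x+e_μ, y) − G_(j)(x, y))| ≤ C·e^{−δ₀|x−y|∕(L^jη)}` (lattice units), ONE `(C, δ₀)` for all volumes, levels and masses `0 < m² ≤ m₀²`
# (Track A, DAG node N15 = NE2; FAN-OUT v1.1 §N15 s3 «KING-MODEL RUNG … + the one-line statement of what the curved case adds»)

HONEST FRAMING.  Count-neutral kernel bookkeeping (cell `pub-ymgap`, seat `pub-ymgap-dag-n15-e` g17; `--supports stmt-QuantumFields-27366 --as helper` =
K3⁸ `SpineGivenEndpointR13SepCoPHV`).  TEMPLATE LITERATURE, `A = 0`: C. King's scalar U(1)-Higgs MODEL on finite tori ([King1986] (2.13)–(2.17) p. 653,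
(2.20) p. 654, Prop. 3.7 (3.63) p. 663, (4.42) p. 675), NOT Bałaban's covariant objects; NE2⁺ is NOT PRINTED for those and not proved; NOT a node
discharge; nothing continuum ∕ ℝ⁴ ∕ OS ∕ mass-gap ∕ Clay.  0 `sorry`, 0 `def`, standard axioms.

THE POINT.  The lit-balaban typer's `King1986/SlicePropagatorStatements.lean` types Proposition 3.7 as a hypothesis schema `SlicePropagator.Prop37Printed D C δ₀`
over ONE `SliceKernels` datum — all slices `G^η_{(j)}`, `0 ≤ j ≤ k − 1`, as kernels on ONE site type `T_η`.  The tree's `A = 0` slices (part F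
`ksSlice` = part K's `G^ε_{j+1} − G^ε_j` by `ksSlice_eq_sub ∕ _eq_king`) live on THEIR OWN carriers `Tor (fine (L^j) (ksU L i))`, one per index
(dag-n15-d's §g16 door census (J): «`Prop37Printed` for genuine slices needs the slice kernels on a common lattice (only `topPiece` exists)»).  THIS FILE
reads every slice of a `k`-level run on the level-`k` fine torus `Tor (fine (L^k) M)` (cube `M_ν = 2L^{e_M}`): for an index `i` with `i.j + i.e + 1 = k + e_M`
the two site types have the same periods (`L^j·(L·2L^{i.e}) = L^k·2L^{e_M}`), so `King1986.TorusCongr.torCongr` identifies them (value-preserving,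
additive, distance-preserving), and part M's ∕ M′'s mass-uniform decays (`ksSlice_decay_unif`, `ksDSlice_decay_unif`), written against the BLOCK distance
of the scale-`j` lattice, become (3.63)'s `e^{−δ₀|x − y|∕(L^jη)}` against the FINE distance (`tdistT_fine_le_blocks`: one `e^{δ}`):
* §1 `sliceCarrier_eq` (the period identity), `tdistT_sliceCast`, `sliceCast_add_unitVec`, ★ `exp_sliceBlockDist_le` (`e^{−δ|B_j(x)−B_j(y)|_U} ≤ e^{δ}·e^{−δ|x−y|_{T_η}∕L^j}`);
* §2 ★★ **`kingSliceG_abs_le`** ((3.63)₁ in lattice units: `|𝒢_j(x, y)| ≤ C·e^{−δ₀|x−y|∕L^j}`), ★★ **`kingSliceDG_abs_le`** ((3.63)₂: `|L^j(𝒢_j(x+e_μ, y) − 𝒢_j(x, y))|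
  ≤ C·e^{−δ₀|x−y|∕L^j}` — part K `ksDSlice_eq_fwdDiff`), ONE `(C, δ₀)` for all `k, e_M`, indices `i` on the carrier, masses `0 < m² ≤ m₀²`.
King's normalisation (`G_(j) := (L^jη)^{2−D}·𝒢_j` at the mass `m²(L^jη)²`, (2.20)) and the remaining clauses of Prop. 3.7 ((3.64): the VECTOR-field
slice along contours, absent in the scalar model; (3.65): the Hölder clauses) are part Ρ-b's ∕ the by-name file's; the schema's `∀ α ∈ (0, 1)` INSIDE one
constant is located on the cell's literature bus (the gradient Hölder clause (3.65)₂ carries `C = C(α)` in King's print and in the tree's letters).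
HONEST SCOPE.  (i) `A = 0`, periodic b.c., odd `L ≥ 3`, `1 ≤ j` (the `j = 0` member `C^{(0),η}` is not a three-factor piece — part Ρ-b), `0 < m² ≤ m₀²`;
(ii) lattice units of the scale-`j` lattice (King's `(L^jη)^{2−D}` and the (2.20) mass scaling are NOT applied here); (iii) not Bałaban's `G(Ω, A)`; not a discharge.
Locators: [King1986] (2.17) p. 653, (2.20) p. 654, Prop. 3.7 (3.63) p. 663, (4.42) p. 675.
-/

noncomputable section

namespace Summit.QuantumFields.YangMills.BalabanUVNodes.N15KingModelRung.Curved

open Real Finset Matrix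
open Literature.MathematicalPhysics.QuantumFieldTheory.Balaban1983to89.B5Prop11Plancherel (Tor fine unitVec)
open Literature.MathematicalPhysics.QuantumFieldTheory.King1986 (aK aK_pos aK_le)
open Literature.MathematicalPhysics.QuantumFieldTheory.King1986.Torus (blockOf tdistT tdistT_nonneg torCongr torCongr_add torCongr_unitVec
  tdistT_torCongr)

variable {d : ℕ} (L : ℕ) [NeZero L]

/-! ## §1 One carrier for all slices of a run -/

omit [NeZero L] in
/-- **THE PERIOD IDENTITY**: for an index `i` with `i.j + i.e + 1 = k + e_M`, the scale-`j` slice's fine torus and the level-`k` fine torus over the cube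
`M_ν = 2L^{e_M}` have the same periods: `L^k·2L^{e_M} = L^j·(L·2L^{i.e})`. [cite: King1986, (2.20) p.654] -/
theorem sliceCarrier_eq (i : KSliceIdx d) {k eM : ℕ} (M : Fin (d + 1) → ℕ) (hM : ∀ μ, M μ = 2 * L ^ eM) (hi : i.j + i.e + 1 = k + eM) :
    ∀ μ, fine (L ^ k) M μ = fine (L ^ i.j) (ksU L i) μ := by
  intro μ
  show L ^ k * M μ = L ^ i.j * (L * (2 * L ^ i.e))
  rw [hM μ]
  have hk : k + eM = i.j + (i.e + 1) := by omega
  calc L ^ k * (2 * L ^ eM) = 2 * L ^ (k + eM) := by rw [pow_add]; ring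
    _ = 2 * L ^ (i.j + (i.e + 1)) := by rw [hk]
    _ = L ^ i.j * (L * (2 * L ^ i.e)) := by rw [pow_add, pow_succ]; ring

/-- The identification preserves the torus distance. [folklore] -/
theorem tdistT_sliceCast (i : KSliceIdx d) {k : ℕ} (M : Fin (d + 1) → ℕ) [∀ μ, NeZero (M μ)]
    (h : ∀ μ, fine (L ^ k) M μ = fine (L ^ i.j) (ksU L i) μ) (x y : Tor (fine (L ^ k) M)) :
    tdistT (fine (L ^ i.j) (ksU L i)) (torCongr h x) (torCongr h y) = tdistT (fine (L ^ k) M) x y :=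
  tdistT_torCongr h x y

omit [NeZero L] in
/-- The identification commutes with unit steps. [folklore] -/
theorem sliceCast_add_unitVec (i : KSliceIdx d) {k : ℕ} (M : Fin (d + 1) → ℕ) (h : ∀ μ, fine (L ^ k) M μ = fine (L ^ i.j) (ksU L i) μ)
    (x : Tor (fine (L ^ k) M)) (μ : Fin (d + 1)) :
    torCongr h (x + unitVec (fine (L ^ k) M) μ) = torCongr h x + unitVec (fine (L ^ i.j) (ksU L i)) μ := by
  rw [torCongr_add, torCongr_unitVec]

/-- ★ **BLOCK DECAY ⇒ FINE DECAY**: `e^{−δ|B_j(x) − B_j(y)|_U} ≤ e^{δ}·e^{−δ|x − y|_{T_η}∕L^j}` (`δ ≥ 0`) — two fine points are at most `L^j`·(the distance of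
their scale-`j` blocks)` + L^j − 1` apart (`tdistT_fine_le_blocks`), and the identification preserves the fine distance. [cite: King1986, Prop. 3.7 (3.63) p.663 (the weight `e^{−δ₀(L^jη)^{−1}|x−y|}`)] -/
theorem exp_sliceBlockDist_le (i : KSliceIdx d) {k : ℕ} (M : Fin (d + 1) → ℕ) [∀ μ, NeZero (M μ)]
    (h : ∀ μ, fine (L ^ k) M μ = fine (L ^ i.j) (ksU L i) μ) {δ : ℝ} (hδ : 0 ≤ δ) (x y : Tor (fine (L ^ k) M)) :
    Real.exp (-(δ * tdistT (ksU L i) (blockOf (L ^ i.j) (ksU L i) (torCongr h x)) (blockOf (L ^ i.j) (ksU L i) (torCongr h y))))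
      ≤ Real.exp δ * Real.exp (-(δ * (tdistT (fine (L ^ k) M) x y / (L : ℝ) ^ i.j))) := by
  have hL0 : (0 : ℝ) < L := by exact_mod_cast Nat.pos_of_ne_zero (NeZero.ne L)
  have hN : (0 : ℝ) < (L : ℝ) ^ i.j := pow_pos hL0 _
  set x' := torCongr h x
  set y' := torCongr h y
  have hfb := tdistT_fine_le_blocks (L ^ i.j) (ksU L i) x' y'
  rw [tdistT_sliceCast] at hfb
  push_cast at hfb
  -- `|x−y| ≤ L^j·|B−B| + (L^j − 1)` ⟹ `|x−y|∕L^j ≤ |B−B| + 1`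
  have hdiv : tdistT (fine (L ^ k) M) x y / (L : ℝ) ^ i.j
      ≤ tdistT (ksU L i) (blockOf (L ^ i.j) (ksU L i) x') (blockOf (L ^ i.j) (ksU L i) y') + 1 := by
    rw [div_le_iff₀ hN]
    nlinarith [tdistT_nonneg (ksU L i) (blockOf (L ^ i.j) (ksU L i) x') (blockOf (L ^ i.j) (ksU L i) y')]
  rw [← Real.exp_add]
  exact Real.exp_le_exp.mpr (by nlinarith)

/-! ## §2 Proposition 3.7's sup clauses (3.63) for every slice `1 ≤ j ≤ k − 1`, on the carrier -/

/-- ★★ **(3.63)₁ ON THE CARRIER** (lattice units): ONE `(C, δ₀)` such that for every mass `0 < m² ≤ m₀²`, every level `k`, volume `M`, index `i` with the period identity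
`h` (e.g. `sliceCarrier_eq`) and fine points `x, y ∈ T_η`: `|𝒢_j(x, y)| ≤ C·e^{−δ₀|x − y|_{T_η}∕L^j}` — King's slice (part K: `𝒢_j = G^ε_{j+1} − G^ε_j`) DECAYS on its own length
`L^jη` (part M `ksSlice_decay_unif` + §1). [cite: King1986, Prop. 3.7 (3.63) p.663 (first display), (4.42) p.675] -/
theorem kingSliceG_abs_le (hLodd : Odd L) (hL : 2 ≤ L) {a : ℝ} (ha : 0 < a) {m0sq : ℝ} (hm0 : 0 ≤ m0sq) :
    ∃ C δ₀ : ℝ, 0 < C ∧ 0 < δ₀ ∧ ∀ (m2 : ℝ), 0 < m2 → m2 ≤ m0sq →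
      ∀ (k : ℕ) (M : Fin (d + 1) → ℕ) [∀ μ, NeZero (M μ)] (i : KSliceIdx d) (h : ∀ μ, fine (L ^ k) M μ = fine (L ^ i.j) (ksU L i) μ)
        (x y : Tor (fine (L ^ k) M)),
        |ksSlice L a m2 i (torCongr h x) (torCongr h y)| ≤ C * Real.exp (-(δ₀ * (tdistT (fine (L ^ k) M) x y / (L : ℝ) ^ i.j))) := by
  obtain ⟨C, δ, hC, hδ, H⟩ := ksSlice_decay_unif (d := d) L hLodd hL ha hm0
  refine ⟨C * Real.exp δ, δ, by positivity, hδ, ?_⟩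
  intro m2 hm hcap k M _ i h x y
  refine ((H m2 hm hcap i).1 _ _).trans ?_
  rw [mul_assoc]
  exact mul_le_mul_of_nonneg_left (exp_sliceBlockDist_le L i M h hδ.le x y) hC.le

/-- ★★ **(3.63)₂ ON THE CARRIER** (lattice units): ONE `(C, δ₀)` such that for every mass `0 < m² ≤ m₀²`, level, cube, index on the carrier, direction `μ` and
fine points `x, y`: `|L^j·(𝒢_j(x + e_μ, y) − 𝒢_j(x, y))| ≤ C·e^{−δ₀|x − y|_{T_η}∕L^j}` — the scale-`j` gradient of the slice (part K `ksDSlice_eq_fwdDiff`: it IS part H's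
`ksDSlice`) decays on the length `L^jη` (part M′ `ksDSlice_decay_unif` + §1). [cite: King1986, Prop. 3.7 (3.63) p.663 (second display), (4.42) p.675] -/
theorem kingSliceDG_abs_le (hLodd : Odd L) (hL : 2 ≤ L) {a : ℝ} (ha : 0 < a) {m0sq : ℝ} (hm0 : 0 ≤ m0sq) :
    ∃ C δ₀ : ℝ, 0 < C ∧ 0 < δ₀ ∧ ∀ (m2 : ℝ), 0 < m2 → m2 ≤ m0sq →
      ∀ (k : ℕ) (M : Fin (d + 1) → ℕ) [∀ μ, NeZero (M μ)] (i : KSliceIdx d) (h : ∀ μ, fine (L ^ k) M μ = fine (L ^ i.j) (ksU L i) μ)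
        (μ : Fin (d + 1)) (x y : Tor (fine (L ^ k) M)),
        |((L ^ i.j : ℕ) : ℝ) * (ksSlice L a m2 i (torCongr h (x + unitVec (fine (L ^ k) M) μ)) (torCongr h y)
            - ksSlice L a m2 i (torCongr h x) (torCongr h y))|
          ≤ C * Real.exp (-(δ₀ * (tdistT (fine (L ^ k) M) x y / (L : ℝ) ^ i.j))) := by
  obtain ⟨C, δ, hC, hδ, H⟩ := ksDSlice_decay_unif (d := d) L hLodd hL ha hm0
  refine ⟨C * Real.exp δ, δ, by positivity, hδ, ?_⟩
  intro m2 hm hcap k M _ i h μ x y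
  rw [sliceCast_add_unitVec, ← ksDSlice_eq_fwdDiff]
  refine (((H m2 hm hcap i μ).1 _ _)).trans ?_
  rw [mul_assoc]
  exact mul_le_mul_of_nonneg_left (exp_sliceBlockDist_le L i M h hδ.le x y) hC.le

/-- **THE CARRIER IS INHABITED**: for every level `k ≥ 2`, slice `1 ≤ j ≤ k − 1` and cube exponent `e_M` there is an index on the carrier (`e := k + e_M − j − 1`,
one extra step `n = 1`, physical volume exponent `0`, size letter `1`). [folklore] -/
theorem exists_sliceIdx_on_carrier {k j : ℕ} (hj : 1 ≤ j) (hjk : j < k) (eM : ℕ) :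
    ∃ i : KSliceIdx d, i.j = j ∧ i.j + i.e + 1 = k + eM :=
  ⟨⟨k + eM - j - 1, j, hj, 1, le_rfl, 0, Nat.zero_le _, 1, le_rfl⟩, rfl, by show j + (k + eM - j - 1) + 1 = k + eM; omega⟩

end Summit.QuantumFields.YangMills.BalabanUVNodes.N15KingModelRung.Curved

end
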